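import Literature.Geometry.Symplectic.GirouxContactPathProofs
import Literature.Geometry.Symplectic.LefschetzSteinOpenBookTransport
import Literature.Topology.FourManifolds.GluingIsotopyProofs
import Literature.Topology.FourManifolds.DiffeotopyProofs
import HarnessLib

/-!
# Every Giroux form of the boundary open book, positive like the Stein contact structure, is the
# form of complex tangencies of a Stein structure (Giroux uniqueness + Gray + isotopy extension)

Topic `Literature/Geometry/Symplectic`; a proofs-only file (no definition, no named fact; D-0026)
on the path of the named fact `Literature.Geometry.Symplectic.palf_stein_supportedByBoundaryOpenBook`
(**S2**, `LefschetzSteinOpenBook.lean`; its docstring, item (5): *"Etnyre's Def. 3.2 allows an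
isotopy of `ξ`, the conclusion asks for a Giroux form of `ξ = boundaryPlaneField S.J bX` itself;
equivalent, because only the existence of `S` is asserted (an isotopy `ψ_t` of `∂X` extends over
a collar to a diffeomorphism `Ψ` of `X`, and `Ψ_* S` is a Stein structure with complex tangencies
`(ψ₁)_* ξ`)"*) and of its one-handle step (`LefschetzSteinOpenBookInduction.lean`, `Hstep`,
item 1: Legendrian realisation of the next vanishing cycle by CHANGING THE GIROUX FORM and then
the Stein structure).

**Theorem** (`exists_steinStructure_isGirouxForm_of_sign_iff`).  Let `X` be a compact
4-manifold with boundary datum `bX`, `S` a Stein structure on `X`, `ob` an open book of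
`∂X = bX.carrier` and `α` a Giroux form of `ob` for the complex tangencies
`ξ_S = boundaryPlaneField S.J bX`.  Then EVERY Giroux form `α'` of `ob` (for whatever plane field
`ξ' = ker α'`) with `α' ∧ dα'` of the same sign as `α ∧ dα` everywhere is the Giroux form of the
complex tangencies of some Stein structure `S'` on `X`: `ob.IsGirouxForm ξ_{S'} α'`.

**Proof** (Etnyre 2006, proof of Prop. 3.18 with Thm. 2.? (Gray); Geiges 2008, Thm. 2.2.2;
Hirsch 1976, Ch. 8 §2, Thm. 2.3), entirely from proved results of the tree:
Giroux's path of contact forms `A_t` from `α'` to `α` (`GirouxContactPath_holds`,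
`GirouxContactPathProofs.lean`), Gray's ambient isotopy `Ψ_t` of `∂X` with
`TΨ_t(ker A_0) = ker A_t` (`GrayStability_holds`), `χ = Ψ_1` is diffeotopic to the identity
(`AmbientIsotopy.isDiffeotopicToId`, `DiffeotopyProofs.lean`), hence extends over a collar to a
diffeomorphism `Φ` of `X` with `Φ ∘ incl = incl ∘ χ`
(`BoundaryData.exists_diffeomorph_comp_incl_eq_of_isDiffeotopicToId_euclidean`,
`GluingIsotopyProofs.lean`), and the pulled-back Stein structure `S' = S.comap Φ`
(`SteinDomainDiffeomorph.lean`) has complex tangencies `(dΦ)⁻¹ ξ_S`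
(`mem_contactPlane_comap_iff`, `LefschetzSteinOpenBookTransport.lean`), which read on `bX`
through the chain rule `dΦ ∘ d(incl) = d(incl) ∘ dχ` are `(dχ)⁻¹ ξ_S = ker α' = ξ'`.

* `exists_steinStructure_isGirouxForm_of_sign_iff` — the theorem;
* `palfConclusion_of_isGirouxForm_of_sign_iff` — the same in the shape of the conclusion of S2
  (Stein structure + Giroux form + positivity of `α ∧ dα` on the frames coming from positive
  boundary frames of `∂ Base g`): the positivity clause passes to `α'` by the sign hypothesis.

Use (one-handle step of S2): to make the next vanishing cycle `K ⊂` page Legendrian it suffices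
to produce a Giroux form `α'` of the SAME open book, positive like `α`, with `α'|_{TK} = 0`; this
file then replaces `(S, α)` by `(S', α')` with `K` Legendrian for `ξ_{S'} = ker α'`, the open book
untouched.

## References
* J. B. Etnyre, *Lectures on open book decompositions and contact structures*, Clay Math. Proc.
  5 (2006), Def. 3.2, Prop. 3.18 and its proof (arXiv:math/0409402). [Etnyre2006]
* H. Geiges, *An Introduction to Contact Topology* (2008), Thm. 2.2.2 (Gray stability).
  [Geiges2008]
* M. W. Hirsch, *Differential Topology* (1976), Ch. 8 §2, Thm. 2.3 (isotopy extension over a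
  collar). [HirschDT1976]
* K. Cieliebak, Ya. Eliashberg, *From Stein to Weinstein and Back* (2012), Ch. 2 (complex
  tangencies of a `J`-convex boundary). [CieliebakEliashberg2012]
-/

noncomputable section

open scoped Manifold ContDiff Topology
open Set Function

namespace Literature.Geometry.Symplectic

open Literature.Topology.FourManifolds Literature.Topology.FourManifolds.HandleAttachingMap
  Literature.Topology.FourManifolds.LefschetzBase Literature.Geometry.Kaehler

/-- **Every Giroux form of the boundary open book in the sign class of the Stein contact structure
is realised as complex tangencies.**  For a compact Stein `(X, S)` with boundary datum `bX`, an
open book `ob` of `bX.carrier`, a Giroux form `α` of `ob` for `ξ_S = boundaryPlaneField S.J bX`,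
and any Giroux form `α'` of `ob` (for a plane field `ξ'`) with
`α ∧ dα > 0 ↔ α' ∧ dα' > 0` on every frame, there is a Stein structure `S'` on `X` whose complex
tangencies admit `α'` as a Giroux form of `ob` — namely `S' = S.comap Φ` for a diffeomorphism
`Φ` of `X` extending the time-one map of Gray's isotopy along Giroux's path from `α'` to `α`.
[cite: Etnyre2006, Prop. 3.18] [cite: Geiges2008, Thm. 2.2.2] [cite: HirschDT1976, Ch. 8 §2, Thm. 2.3] -/
theorem exists_steinStructure_isGirouxForm_of_sign_iff
    {X : Type} [TopologicalSpace X] [T2Space X] [CompactSpace X]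
    [ChartedSpace (EuclideanHalfSpace 4) X] [IsManifold (𝓡∂ 4) ∞ X]
    (bX : BoundaryData (𝓡∂ 4) X (𝓡 3)) (ob : OpenBook bX.carrier) (S : SteinStructure X)
    {ξ' : bX.carrier → Submodule ℝ (EuclideanSpace ℝ (Fin 3))}
    {α α' : MForm (𝓡 3) bX.carrier ℝ 1}
    (hα : ob.IsGirouxForm (boundaryPlaneField S.J bX) α) (hα' : ob.IsGirouxForm ξ' α')
    (hsign : ∀ y u v w, 0 < wedge₁₂ (α y) (mextDeriv α y) u v w ↔
      0 < wedge₁₂ (α' y) (mextDeriv α' y) u v w) :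
    ∃ S' : SteinStructure X, ob.IsGirouxForm (boundaryPlaneField S'.J bX) α' := by
  haveI : CompactSpace bX.carrier := bX.compactSpace_carrier
  haveI : T2Space bX.carrier := bX.isSmoothEmbedding.isEmbedding.t2Space
  -- Giroux's path of contact forms from `α'` to `α`
  obtain ⟨A, hA0, hA1, hAs, hAc⟩ := GirouxContactPath_holds bX.carrier ob ξ'
    (boundaryPlaneField S.J bX) α' α hα' hα fun y u v w => (hsign y u v w).symm
  -- Gray's isotopy along it, and its time-one map
  obtain ⟨Ψ, hΨ⟩ := GrayStability_holds bX.carrier A hAs hAc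
  set χ : bX.carrier ≃ₘ⟮𝓡 3, 𝓡 3⟯ bX.carrier := Ψ.toDiffeomorph 1 with hχdef
  have hχ : Diffeomorph.IsDiffeotopicToId χ := Ψ.isDiffeotopicToId 1
  -- extension over a collar to a diffeomorphism of `X`
  obtain ⟨Φ, hΦ⟩ := bX.exists_diffeomorph_comp_incl_eq_of_isDiffeotopicToId_euclidean hχ
  refine ⟨S.comap Φ, hα'.congr_planeField fun y => ?_⟩
  -- the complex tangencies of `S.comap Φ` on `bX` are `ker α' = ξ'`
  have hG := hΨ 1 ⟨zero_le_one, le_rfl⟩ y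
  rw [hA0, hA1] at hG
  have hpt : Φ (bX.incl y) = bX.incl (χ y) := congrFun hΦ y
  have hvec : ∀ v : EuclideanSpace ℝ (Fin 3),
      mfderiv (𝓡∂ 4) (𝓡∂ 4) Φ (bX.incl y) (mfderiv (𝓡 3) (𝓡∂ 4) bX.incl y v) =
        mfderiv (𝓡 3) (𝓡∂ 4) bX.incl (χ y) (mfderiv (𝓡 3) (𝓡 3) χ y v) := by
    intro v
    have c1 := mfderiv_comp y ((Φ.contMDiff (bX.incl y)).mdifferentiableAt (by simp))
      ((bX.isSmoothEmbedding.contMDiff y).mdifferentiableAt (by simp))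
    have c2 := mfderiv_comp y ((bX.isSmoothEmbedding.contMDiff (χ y)).mdifferentiableAt (by simp))
      ((χ.contMDiff y).mdifferentiableAt (by simp))
    have hfun : (⇑Φ ∘ bX.incl) = (bX.incl ∘ ⇑χ) := hΦ
    rw [hfun] at c1
    exact ContinuousLinearMap.ext_iff.1 (c1.symm.trans c2) v
  -- membership in `contactPlane S.J x` does not see the base point of the tangent vector
  have hcongr : ∀ {x x' : X} (_ : x = x') {w : EuclideanSpace ℝ (Fin 4)},
      w ∈ contactPlane S.J x ↔ w ∈ contactPlane S.J x' := by
    intro x x' hx w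
    subst hx
    exact Iff.rfl
  ext v
  constructor
  · intro hv
    have h1 : α' y ![v] = 0 := (hα'.ker_eq y v).2 hv
    have h2 : α (χ y) ![mfderiv (𝓡 3) (𝓡 3) χ y v] = 0 := (hG v).1 h1
    have h3 : (mfderiv (𝓡 3) (𝓡∂ 4) bX.incl (χ y) (mfderiv (𝓡 3) (𝓡 3) χ y v) :
        EuclideanSpace ℝ (Fin 4)) ∈ contactPlane S.J (bX.incl (χ y)) := (hα.ker_eq _ _).1 h2
    have h4 : (mfderiv (𝓡∂ 4) (𝓡∂ 4) Φ (bX.incl y) (mfderiv (𝓡 3) (𝓡∂ 4) bX.incl y v) :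
        EuclideanSpace ℝ (Fin 4)) ∈ contactPlane S.J (bX.incl (χ y)) := by
      rw [hvec v]
      exact h3
    have h5 : (mfderiv (𝓡∂ 4) (𝓡∂ 4) Φ (bX.incl y) (mfderiv (𝓡 3) (𝓡∂ 4) bX.incl y v) :
        EuclideanSpace ℝ (Fin 4)) ∈ contactPlane S.J (Φ (bX.incl y)) := (hcongr hpt).2 h4
    exact (mem_contactPlane_comap_iff Φ S (bX.incl_mem_boundary y)
      (mfderiv (𝓡 3) (𝓡∂ 4) bX.incl y v)).2 h5
  · intro hv
    have h5 : (mfderiv (𝓡∂ 4) (𝓡∂ 4) Φ (bX.incl y) (mfderiv (𝓡 3) (𝓡∂ 4) bX.incl y v) :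
        EuclideanSpace ℝ (Fin 4)) ∈ contactPlane S.J (Φ (bX.incl y)) :=
      (mem_contactPlane_comap_iff Φ S (bX.incl_mem_boundary y)
        (mfderiv (𝓡 3) (𝓡∂ 4) bX.incl y v)).1 hv
    have h4 : (mfderiv (𝓡∂ 4) (𝓡∂ 4) Φ (bX.incl y) (mfderiv (𝓡 3) (𝓡∂ 4) bX.incl y v) :
        EuclideanSpace ℝ (Fin 4)) ∈ contactPlane S.J (bX.incl (χ y)) := (hcongr hpt).1 h5
    have h3 : (mfderiv (𝓡 3) (𝓡∂ 4) bX.incl (χ y) (mfderiv (𝓡 3) (𝓡 3) χ y v) :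
        EuclideanSpace ℝ (Fin 4)) ∈ contactPlane S.J (bX.incl (χ y)) := by
      rw [← hvec v]
      exact h4
    have h2 : α (χ y) ![mfderiv (𝓡 3) (𝓡 3) χ y v] = 0 := (hα.ker_eq _ _).2 h3
    have h1 : α' y ![v] = 0 := (hG v).2 h2
    exact (hα'.ker_eq y v).1 h1

/-- **The same in the shape of the conclusion of `palf_stein_supportedByBoundaryOpenBook`.**
For a multi-attachment `(X, D)` of a family `h` on `Base g` with boundary datum `bX` and an open
book `ob` of `bX.carrier`: if `X` carries a Stein structure `S` with a Giroux form `α` of `ob`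
for its complex tangencies, `α ∧ dα > 0` on the frames of `T∂X` coming from positive boundary
frames of `∂ Base g`, then for every other Giroux form `α'` of `ob` of the same sign as `α`
there is a Stein structure `S'` with `α'` a Giroux form of ITS complex tangencies and the same
positivity clause (which only involves `α' ∧ dα'`).  In the one-handle step of S2 this replaces
`(S, α)` by `(S', α')` with a prescribed page curve Legendrian, the open book untouched.
[cite: Etnyre2006, Prop. 3.18] [cite: AkbulutOzbagci2001, Thm. 5] -/
theorem palfConclusion_of_isGirouxForm_of_sign_iff {g : ℕ} {ι : Type} [Finite ι]
    {h : ι → HandleAttachingMap 3 2 (Base g)}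
    {X : Type} [TopologicalSpace X] [T2Space X] [CompactSpace X]
    [ChartedSpace (EuclideanHalfSpace 4) X] [IsManifold (𝓡∂ 4) ∞ X]
    (D : MultiAttachmentData h (𝓡∂ 4) X) (bX : BoundaryData (𝓡∂ 4) X (𝓡 3))
    (ob : OpenBook bX.carrier) (S : SteinStructure X) {α : MForm (𝓡 3) bX.carrier ℝ 1}
    (hα : ob.IsGirouxForm (boundaryPlaneField S.J bX) α)
    (hpos : ∀ (y : bX.carrier) (a : ↥(coresComplement h)) (u : Fin 3 → EuclideanSpace ℝ (Fin 3))
        (v : Fin 3 → EuclideanSpace ℝ (Fin 4)),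
        bX.incl y = D.jA a →
        (∀ k, mfderiv (𝓡 3) (𝓡∂ 4) bX.incl y (u k) = mfderiv (𝓡∂ 4) (𝓡∂ 4) D.jA a (v k)) →
        IsPosBdryFrame h a v →
        0 < wedge₁₂ (α y) (mextDeriv α y) (u 0) (u 1) (u 2))
    {ξ' : bX.carrier → Submodule ℝ (EuclideanSpace ℝ (Fin 3))} {α' : MForm (𝓡 3) bX.carrier ℝ 1}
    (hα' : ob.IsGirouxForm ξ' α')
    (hsign : ∀ y u v w, 0 < wedge₁₂ (α y) (mextDeriv α y) u v w ↔
      0 < wedge₁₂ (α' y) (mextDeriv α' y) u v w) :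
    ∃ S' : SteinStructure X, ob.IsGirouxForm (boundaryPlaneField S'.J bX) α' ∧
      ∀ (y : bX.carrier) (a : ↥(coresComplement h)) (u : Fin 3 → EuclideanSpace ℝ (Fin 3))
        (v : Fin 3 → EuclideanSpace ℝ (Fin 4)),
        bX.incl y = D.jA a →
        (∀ k, mfderiv (𝓡 3) (𝓡∂ 4) bX.incl y (u k) = mfderiv (𝓡∂ 4) (𝓡∂ 4) D.jA a (v k)) →
        IsPosBdryFrame h a v →
        0 < wedge₁₂ (α' y) (mextDeriv α' y) (u 0) (u 1) (u 2) := by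
  obtain ⟨S', hS'⟩ := exists_steinStructure_isGirouxForm_of_sign_iff bX ob S hα hα' hsign
  exact ⟨S', hS', fun y a u v hya hfr hposfr =>
    (hsign y (u 0) (u 1) (u 2)).1 (hpos y a u v hya hfr hposfr)⟩

end Literature.Geometry.Symplectic

end
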